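import Summits.Ventures.LatticeQCDFlow.Exactness.NonreversibleDirichletComparison
import Summits.Ventures.LatticeQCDFlow.Exactness.AdjointSamplerAutocovariance
import HarnessLib

/-!
# A FIXED-ORDER two-step sweep `P₁P₂` of reversible updates is never worse — for every observable — than (a) the RANDOM-ORDER sweep `½(P₁P₂ + P₂P₁)` and (b) two steps of RANDOM SCAN `(½(P₁ + P₂))²`

HONEST FRAMING: exact (Metropolis-corrected) sampling algorithms for lattice gauge theory;
figures of merit are autocorrelation/cost numbers at stated couplings and volumes; no
continuum-physics claim.

Venture `LatticeQCDFlow` (cell pub-lqcd), topic `Exactness`; FANOUT row 8 (`s0-cpn-nemc`, GEN-24).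
NEW WORK of the cell: two ADJOINT-FREE instances of the non-reversible comparison theorem
`RevOp.abelSum_le_of_quadForm_le_nonrev` (`Exactness/NonreversibleDirichletComparison.lean`) in row 2's
format `RevOp` (weight `w ≥ 0`, admissible class `A` with (int) (comb); two REVERSIBLE exact samplers
`P₁`, `P₂` of the same target on the class: (stab) (lin) (symm) (contr)).  Elementary; nothing is cited
as a fact.  Printed counterparts NAMED ONLY: Maire–Douc–Olsson, Ann. Statist. 42 (2014) 1483 (the
deterministic-update two-component Gibbs sampler has smaller asymptotic variance than the random-scan
one); Greenwood–McKeague–Wefelmeyer 1998 and Andrieu 2016 for related scan-order comparisons.  The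
finite-state fact that the reversed scan is the `π`-adjoint of the forward scan is row 9's
`Exactness/SequentialScanAdjoint.lean`; here no adjoint is needed.

## Content

The operators are given by pointwise identities ON THE CLASS (no definition is introduced): the ORDERED SWEEP
`K f = P₁ (P₂ f)`, the REVERSED sweep `K' f = P₂ (P₁ f)`, the RANDOM-ORDER SWEEP `S f = ½(K f + K' f)` (flip a fair
coin, then run the two updates in that order), the RANDOM-SCAN STEP `R f = ½(P₁ f + P₂ f)` (pick one of the two
updates at random) and TWO random-scan steps `T f = R (R f)` (equal cost: two elementary updates per
unit, as for `K` and `S`).  With `⟨u, v⟩ = ∫ u v w`: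

* `K` is an exact sampler on the class ((stab) (lin) (contr)) — NOT reversible in general — with
  quadratic form `⟨v, K v⟩ = ⟨P₁ v, P₂ v⟩` (`integral_mul_comp_eq`);
* the two orders `K = P₁P₂`, `K' = P₂P₁` are ADJOINT on the class (`comp_adjoint`), so they score
  identically (`RevOp.autocov_eq_of_adjoint`) and `S = ½(K + K')` is their additive reversibilization
  (reversible with the same Dirichlet form: `Exactness/AdjointSamplerAutocovariance.addRev_*`); `T` is a
  REVERSIBLE exact sampler (`scan_*`) with
  `⟨v, T v⟩ = ‖R v‖² = ⟨P₁ v, P₂ v⟩ + ¼‖P₁ v − P₂ v‖² ≥ ⟨v, K v⟩` (`integral_mul_comp_le_scanTwo`);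
* hence, for every `g ∈ A` and `0 ≤ r < 1` (Abel form, unconditional):
  **`abelSum_ordered_le_randomOrder`** — `Σ_k C_K(k) rᵏ ≤ Σ_k C_S(k) rᵏ`, and
  **`abelSum_ordered_le_randomScanTwo`** — `Σ_k C_K(k) rᵏ ≤ Σ_k C_T(k) rᵏ`
  (`C_T(k) = ⟨g, R^{2k} g⟩`: the random-scan chain read every second step);
* **`tauInt_ordered_le_randomScanTwo`** — under summability of both normalised series (`∫ g² w > 0`):
  `τ_int(g; P₁P₂) ≤ τ_int(g; R²)` (`Scoring.tauInt`), and `tauInt_ordered_le_randomOrder` likewise.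

Reading: for a two-block scheme (even/odd sites, links/sites of `cpn_2d`, gauge field / pseudofermion
refresh, the two factors of a split flow proposal) built from reversible block updates, committing to
ONE order costs nothing in integrated autocorrelation against randomising the order or the block —
observable by observable, whatever the target.  NOT CLAIMED: more than two blocks (the `n`-block
forward sweep against the forward/backward coin is the companion file); any comparison between the two
orders `P₁P₂` and `P₂P₁` themselves; mixing-time statements; any number of ours.
-/

namespace Summit.Ventures.LatticeQCDFlow.Exactness

open Real MeasureTheory Filter Finset Topology
open Summit.Ventures.LatticeQCDFlow.Scoring

namespace RevOp

variable {X : Type*} [MeasurableSpace X] {μ : Measure X} {w : X → ℝ} {A : (X → ℝ) → Prop}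
  {P₁ P₂ K K' S R T : (X → ℝ) → (X → ℝ)}

/-! (§0 — midpoint bookkeeping `half_add_mem`, `integral_half_add_mul`, `integral_half_add_sq_le` —
is `Exactness/AdjointSamplerAutocovariance.lean`.) -/

/-! ## §1 The ordered sweep `K = P₁P₂`: an exact sampler with `⟨v, K v⟩ = ⟨P₁ v, P₂ v⟩` -/

section Ordered

variable (hA1 : ∀ ⦃f : X → ℝ⦄, A f → A (P₁ f)) (hA2 : ∀ ⦃f : X → ℝ⦄, A f → A (P₂ f))
  (hlin1 : ∀ ⦃f h : X → ℝ⦄ (c : ℝ), A f → A h → ∀ x, P₁ (fun s => f s + c * h s) x = P₁ f x + c * P₁ h x)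
  (hlin2 : ∀ ⦃f h : X → ℝ⦄ (c : ℝ), A f → A h → ∀ x, P₂ (fun s => f s + c * h s) x = P₂ f x + c * P₂ h x)
  (hK : ∀ ⦃f : X → ℝ⦄, A f → ∀ x, K f x = P₁ (P₂ f) x)

omit [MeasurableSpace X] in
include hA1 hA2 hK in
/-- (stab) for the ordered sweep. -/
theorem comp_mem : ∀ ⦃f : X → ℝ⦄, A f → A (K f) := fun f hf => by
  rw [show K f = P₁ (P₂ f) from funext (hK hf)]; exact hA1 (hA2 hf)

omit [MeasurableSpace X] in
include hA2 hlin1 hlin2 hK in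
/-- (lin) for the ordered sweep. -/
theorem comp_lin (hAc : ∀ ⦃f h : X → ℝ⦄ (c : ℝ), A f → A h → A (fun x => f x + c * h x)) :
    ∀ ⦃f h : X → ℝ⦄ (c : ℝ), A f → A h →
    ∀ x, K (fun s => f s + c * h s) x = K f x + c * K h x := by
  intro f h c hf hh x
  rw [hK (hAc c hf hh), hK hf, hK hh, show P₂ (fun s => f s + c * h s) = fun s => P₂ f s + c * P₂ h s
    from funext (hlin2 c hf hh)]
  exact hlin1 c (hA2 hf) (hA2 hh) x

include hA2 hK in
/-- (contr) for the ordered sweep. -/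
theorem comp_contr
    (hcontr1 : ∀ ⦃f : X → ℝ⦄, A f → ∫ x, P₁ f x ^ 2 * w x ∂μ ≤ ∫ x, f x ^ 2 * w x ∂μ)
    (hcontr2 : ∀ ⦃f : X → ℝ⦄, A f → ∫ x, P₂ f x ^ 2 * w x ∂μ ≤ ∫ x, f x ^ 2 * w x ∂μ) :
    ∀ ⦃f : X → ℝ⦄, A f → ∫ x, K f x ^ 2 * w x ∂μ ≤ ∫ x, f x ^ 2 * w x ∂μ := fun f hf => by
  rw [show K f = P₁ (P₂ f) from funext (hK hf)]
  exact (hcontr1 (hA2 hf)).trans (hcontr2 hf)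

include hA2 hK in
/-- **`⟨v, K v⟩ = ⟨P₁ v, P₂ v⟩`** for the ordered sweep (reversibility of `P₁` only). -/
theorem integral_mul_comp_eq
    (hsymm1 : ∀ ⦃f h : X → ℝ⦄, A f → A h → ∫ x, P₁ f x * h x * w x ∂μ = ∫ x, f x * P₁ h x * w x ∂μ)
    {v : X → ℝ} (hv : A v) :
    ∫ x, v x * K v x * w x ∂μ = ∫ x, P₁ v x * P₂ v x * w x ∂μ := by
  rw [show K v = P₁ (P₂ v) from funext (hK hv)]
  exact (hsymm1 hv (hA2 hv)).symm

end Ordered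

/-! ## §2 The two orders are adjoint; the random-order sweep is their additive reversibilization -/

section RandomOrder

variable (hw0 : ∀ x, 0 ≤ w x)
  (hAi : ∀ ⦃f h : X → ℝ⦄, A f → A h → Integrable (fun x => f x * h x * w x) μ)
  (hAc : ∀ ⦃f h : X → ℝ⦄ (c : ℝ), A f → A h → A (fun x => f x + c * h x))
  (hA1 : ∀ ⦃f : X → ℝ⦄, A f → A (P₁ f)) (hA2 : ∀ ⦃f : X → ℝ⦄, A f → A (P₂ f))
  (hlin1 : ∀ ⦃f h : X → ℝ⦄ (c : ℝ), A f → A h → ∀ x, P₁ (fun s => f s + c * h s) x = P₁ f x + c * P₁ h x)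
  (hlin2 : ∀ ⦃f h : X → ℝ⦄ (c : ℝ), A f → A h → ∀ x, P₂ (fun s => f s + c * h s) x = P₂ f x + c * P₂ h x)
  (hsymm1 : ∀ ⦃f h : X → ℝ⦄, A f → A h → ∫ x, P₁ f x * h x * w x ∂μ = ∫ x, f x * P₁ h x * w x ∂μ)
  (hsymm2 : ∀ ⦃f h : X → ℝ⦄, A f → A h → ∫ x, P₂ f x * h x * w x ∂μ = ∫ x, f x * P₂ h x * w x ∂μ)
  (hcontr1 : ∀ ⦃f : X → ℝ⦄, A f → ∫ x, P₁ f x ^ 2 * w x ∂μ ≤ ∫ x, f x ^ 2 * w x ∂μ)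
  (hcontr2 : ∀ ⦃f : X → ℝ⦄, A f → ∫ x, P₂ f x ^ 2 * w x ∂μ ≤ ∫ x, f x ^ 2 * w x ∂μ)
  (hK : ∀ ⦃f : X → ℝ⦄, A f → ∀ x, K f x = P₁ (P₂ f) x)
  (hK' : ∀ ⦃f : X → ℝ⦄, A f → ∀ x, K' f x = P₂ (P₁ f) x)
  (hS : ∀ ⦃f : X → ℝ⦄, A f → ∀ x, S f x = (K f x + K' f x) / 2)

include hA1 hA2 hsymm1 hsymm2 hK hK' in
/-- **The two orders are ADJOINT on the class**: `∫ (P₁P₂ f) h w = ∫ f (P₂P₁ h) w`. -/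
theorem comp_adjoint : ∀ ⦃f h : X → ℝ⦄, A f → A h →
    ∫ x, K f x * h x * w x ∂μ = ∫ x, f x * K' h x * w x ∂μ := by
  intro f h hf hh
  rw [show K f = P₁ (P₂ f) from funext (hK hf), show K' h = P₂ (P₁ h) from funext (hK' hh),
    hsymm1 (hA2 hf) hh]
  exact hsymm2 hf (hA1 hh)

/-! Both orders score identically at every lag: `RevOp.autocov_eq_of_adjoint` with `comp_adjoint`. -/

include hw0 hAi hAc hA1 hA2 hlin1 hlin2 hsymm1 hsymm2 hcontr1 hcontr2 hK hK' hS in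
/-- **ORDERED SWEEP ≤ RANDOM-ORDER SWEEP (Abel form, unconditional)**: with `K = P₁P₂`, `K' = P₂P₁` and
`S = ½(K + K')` (their additive reversibilization — reversible with the same Dirichlet form,
`Exactness/AdjointSamplerAutocovariance`), for every `g ∈ A` and `0 ≤ r < 1`:
`Σ_k ⟨g, Kᵏ g⟩ rᵏ ≤ Σ_k ⟨g, Sᵏ g⟩ rᵏ`. -/
theorem abelSum_ordered_le_randomOrder {g : X → ℝ} (hg : A g) {r : ℝ} (hr0 : 0 ≤ r) (hr1 : r < 1) :
    ∑' k, (∫ x, g x * (K^[k] g) x * w x ∂μ) * r ^ k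
      ≤ ∑' k, (∫ x, g x * (S^[k] g) x * w x ∂μ) * r ^ k := by
  have hKm := comp_mem hA1 hA2 hK
  have hK'm := comp_mem hA2 hA1 hK'
  have hKl := comp_lin hA2 hlin1 hlin2 hK hAc
  have hK'l := comp_lin hA1 hlin2 hlin1 hK' hAc
  have hKc := comp_contr hA2 hK hcontr1 hcontr2
  have hadj := comp_adjoint hA1 hA2 hsymm1 hsymm2 hK hK'
  exact abelSum_le_of_quadForm_le_nonrev hw0 hAi hAc hKm hKl hKc (addRev_mem hAc hKm hK'm hS)
    (addRev_lin hAc hKl hK'l hS) (addRev_symm hAi hKm hK'm hadj hS)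
    (addRev_contr hw0 hAi hKm hK'm hadj hKc hS)
    (fun v hv => (quadForm_addRev_eq hAi hKm hK'm hadj hS hv).symm.le) hg hr0 hr1

include hw0 hAi hAc hA1 hA2 hlin1 hlin2 hsymm1 hsymm2 hcontr1 hcontr2 hK hK' hS in
/-- **`τ_int(g; P₁P₂) ≤ τ_int(g; ½(P₁P₂ + P₂P₁))`** under summability of both normalised
autocorrelation series (`∫ g² w > 0`). -/
theorem tauInt_ordered_le_randomOrder {g : X → ℝ} (hg : A g) (hP : 0 < ∫ x, g x ^ 2 * w x ∂μ)
    (hsK : Summable fun n => (∫ x, g x * (K^[n + 1] g) x * w x ∂μ) / ∫ x, g x ^ 2 * w x ∂μ)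
    (hsS : Summable fun n => (∫ x, g x * (S^[n + 1] g) x * w x ∂μ) / ∫ x, g x ^ 2 * w x ∂μ) :
    tauInt (fun n => (∫ x, g x * (K^[n] g) x * w x ∂μ) / ∫ x, g x ^ 2 * w x ∂μ)
      ≤ tauInt (fun n => (∫ x, g x * (S^[n] g) x * w x ∂μ) / ∫ x, g x ^ 2 * w x ∂μ) := by
  have hKm := comp_mem hA1 hA2 hK
  have hK'm := comp_mem hA2 hA1 hK'
  have hKl := comp_lin hA2 hlin1 hlin2 hK hAc
  have hK'l := comp_lin hA1 hlin2 hlin1 hK' hAc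
  have hKc := comp_contr hA2 hK hcontr1 hcontr2
  have hadj := comp_adjoint hA1 hA2 hsymm1 hsymm2 hK hK'
  exact tauInt_le_nonrev hw0 hAi hAc hKm hKl hKc (addRev_mem hAc hKm hK'm hS)
    (addRev_lin hAc hKl hK'l hS) (addRev_symm hAi hKm hK'm hadj hS)
    (addRev_contr hw0 hAi hKm hK'm hadj hKc hS)
    (fun v hv => (quadForm_addRev_eq hAi hKm hK'm hadj hS hv).symm.le) hg hP hsK hsS

end RandomOrder

/-! ## §3 Two random-scan steps `T = R²`, `R = ½(P₁ + P₂)`: reversible, and `⟨v, T v⟩ ≥ ⟨v, K v⟩` -/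

section RandomScan

variable (hw0 : ∀ x, 0 ≤ w x)
  (hAi : ∀ ⦃f h : X → ℝ⦄, A f → A h → Integrable (fun x => f x * h x * w x) μ)
  (hAc : ∀ ⦃f h : X → ℝ⦄ (c : ℝ), A f → A h → A (fun x => f x + c * h x))
  (hA1 : ∀ ⦃f : X → ℝ⦄, A f → A (P₁ f)) (hA2 : ∀ ⦃f : X → ℝ⦄, A f → A (P₂ f))
  (hlin1 : ∀ ⦃f h : X → ℝ⦄ (c : ℝ), A f → A h → ∀ x, P₁ (fun s => f s + c * h s) x = P₁ f x + c * P₁ h x)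
  (hlin2 : ∀ ⦃f h : X → ℝ⦄ (c : ℝ), A f → A h → ∀ x, P₂ (fun s => f s + c * h s) x = P₂ f x + c * P₂ h x)
  (hsymm1 : ∀ ⦃f h : X → ℝ⦄, A f → A h → ∫ x, P₁ f x * h x * w x ∂μ = ∫ x, f x * P₁ h x * w x ∂μ)
  (hsymm2 : ∀ ⦃f h : X → ℝ⦄, A f → A h → ∫ x, P₂ f x * h x * w x ∂μ = ∫ x, f x * P₂ h x * w x ∂μ)
  (hcontr1 : ∀ ⦃f : X → ℝ⦄, A f → ∫ x, P₁ f x ^ 2 * w x ∂μ ≤ ∫ x, f x ^ 2 * w x ∂μ)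
  (hcontr2 : ∀ ⦃f : X → ℝ⦄, A f → ∫ x, P₂ f x ^ 2 * w x ∂μ ≤ ∫ x, f x ^ 2 * w x ∂μ)
  (hR : ∀ ⦃f : X → ℝ⦄, A f → ∀ x, R f x = (P₁ f x + P₂ f x) / 2)

omit [MeasurableSpace X] in
include hAc hA1 hA2 hR in
/-- (stab) for the random-scan step. -/
theorem scan_mem : ∀ ⦃f : X → ℝ⦄, A f → A (R f) := fun f hf => by
  rw [show R f = fun x => (P₁ f x + P₂ f x) / 2 from funext (hR hf)]
  exact half_add_mem hAc (hA1 hf) (hA2 hf)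

omit [MeasurableSpace X] in
include hAc hlin1 hlin2 hR in
/-- (lin) for the random-scan step. -/
theorem scan_lin : ∀ ⦃f h : X → ℝ⦄ (c : ℝ), A f → A h →
    ∀ x, R (fun s => f s + c * h s) x = R f x + c * R h x := by
  intro f h c hf hh x
  rw [hR (hAc c hf hh), hR hf, hR hh, hlin1 c hf hh x, hlin2 c hf hh x]
  ring

include hAi hA1 hA2 hsymm1 hsymm2 hR in
/-- (symm) for the random-scan step. -/
theorem scan_symm : ∀ ⦃f h : X → ℝ⦄, A f → A h →
    ∫ x, R f x * h x * w x ∂μ = ∫ x, f x * R h x * w x ∂μ := by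
  intro f h hf hh
  rw [show R f = fun x => (P₁ f x + P₂ f x) / 2 from funext (hR hf),
    show R h = fun x => (P₁ h x + P₂ h x) / 2 from funext (hR hh),
    integral_half_add_mul hAi (hA1 hf) (hA2 hf) hh, hsymm1 hf hh, hsymm2 hf hh]
  have e : ∫ x, f x * ((P₁ h x + P₂ h x) / 2) * w x ∂μ = ∫ x, (P₁ h x + P₂ h x) / 2 * f x * w x ∂μ :=
    integral_congr_ae (Eventually.of_forall fun x => by ring)
  rw [e, integral_half_add_mul hAi (hA1 hh) (hA2 hh) hf]
  have e1 : ∫ x, f x * P₁ h x * w x ∂μ = ∫ x, P₁ h x * f x * w x ∂μ :=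
    integral_congr_ae (Eventually.of_forall fun x => by ring)
  have e2 : ∫ x, f x * P₂ h x * w x ∂μ = ∫ x, P₂ h x * f x * w x ∂μ :=
    integral_congr_ae (Eventually.of_forall fun x => by ring)
  rw [e1, e2]

include hw0 hAi hA1 hA2 hcontr1 hcontr2 hR in
/-- (contr) for the random-scan step. -/
theorem scan_contr : ∀ ⦃f : X → ℝ⦄, A f → ∫ x, R f x ^ 2 * w x ∂μ ≤ ∫ x, f x ^ 2 * w x ∂μ := by
  intro f hf
  rw [show R f = fun x => (P₁ f x + P₂ f x) / 2 from funext (hR hf)]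
  refine (integral_half_add_sq_le hw0 hAi (hA1 hf) (hA2 hf)).trans ?_
  linarith [hcontr1 hf, hcontr2 hf]

include hAi hAc hA1 hA2 hsymm1 hsymm2 hR in
/-- **`⟨v, P₁(P₂ v)⟩ ≤ ⟨v, R(R v)⟩`**: `‖R v‖² − ⟨P₁ v, P₂ v⟩ = ¼ ‖P₁ v − P₂ v‖² ≥ 0`. -/
theorem integral_mul_comp_le_scanTwo (hw0 : ∀ x, 0 ≤ w x)
    (hK : ∀ ⦃f : X → ℝ⦄, A f → ∀ x, K f x = P₁ (P₂ f) x) (hT : ∀ ⦃f : X → ℝ⦄, A f → ∀ x, T f x = R (R f) x)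
    {v : X → ℝ} (hv : A v) :
    ∫ x, v x * K v x * w x ∂μ ≤ ∫ x, v x * T v x * w x ∂μ := by
  have hRv := scan_mem hAc hA1 hA2 hR hv
  rw [integral_mul_comp_eq hA2 hK hsymm1 hv, show T v = R (R v) from funext (hT hv),
    ← scan_symm hAi hA1 hA2 hsymm1 hsymm2 hR hv hRv]
  have i1 := hAi (hA1 hv) (hA2 hv)
  have i2 := hAi hRv hRv
  rw [← sub_nonneg, ← integral_sub i2 i1]
  refine integral_nonneg fun x => ?_
  show 0 ≤ R v x * R v x * w x - P₁ v x * P₂ v x * w x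
  have e : R v x * R v x * w x - P₁ v x * P₂ v x * w x = ((P₁ v x - P₂ v x) / 2) ^ 2 * w x := by
    rw [hR hv]; ring
  rw [e]
  exact mul_nonneg (sq_nonneg _) (hw0 x)

include hw0 hAi hAc hA1 hA2 hlin1 hlin2 hsymm1 hsymm2 hcontr1 hcontr2 hR in
/-- **ORDERED SWEEP ≤ TWO RANDOM-SCAN STEPS (Abel form, unconditional; equal cost)**: with
`K f = P₁(P₂ f)`, `R f = ½(P₁ f + P₂ f)`, `T f = R(R f)`, for every `g ∈ A` and `0 ≤ r < 1`:
`Σ_k ⟨g, Kᵏ g⟩ rᵏ ≤ Σ_k ⟨g, R^{2k} g⟩ rᵏ`. -/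
theorem abelSum_ordered_le_randomScanTwo
    (hK : ∀ ⦃f : X → ℝ⦄, A f → ∀ x, K f x = P₁ (P₂ f) x) (hT : ∀ ⦃f : X → ℝ⦄, A f → ∀ x, T f x = R (R f) x)
    {g : X → ℝ} (hg : A g) {r : ℝ} (hr0 : 0 ≤ r) (hr1 : r < 1) :
    ∑' k, (∫ x, g x * (K^[k] g) x * w x ∂μ) * r ^ k
      ≤ ∑' k, (∫ x, g x * (T^[k] g) x * w x ∂μ) * r ^ k := by
  have hRm := scan_mem hAc hA1 hA2 hR
  have hRl := scan_lin hAc hlin1 hlin2 hR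
  have hRs := scan_symm hAi hA1 hA2 hsymm1 hsymm2 hR
  have hRc := scan_contr hw0 hAi hA1 hA2 hcontr1 hcontr2 hR
  exact abelSum_le_of_quadForm_le_nonrev hw0 hAi hAc (comp_mem hA1 hA2 hK) (comp_lin hA2 hlin1 hlin2 hK hAc)
    (comp_contr hA2 hK hcontr1 hcontr2) (comp_mem hRm hRm hT) (comp_lin hRm hRl hRl hT hAc)
    (fun f h hf hh => by
      rw [show T f = R (R f) from funext (hT hf), show T h = R (R h) from funext (hT hh),
        hRs (hRm hf) hh, hRs hf (hRm hh)])
    (comp_contr hRm hT hRc hRc)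
    (fun v hv => integral_mul_comp_le_scanTwo hAi hAc hA1 hA2 hsymm1 hsymm2 hR hw0 hK hT hv) hg hr0 hr1

include hw0 hAi hAc hA1 hA2 hlin1 hlin2 hsymm1 hsymm2 hcontr1 hcontr2 hR in
/-- **`τ_int(g; P₁P₂) ≤ τ_int(g; R²)`** (two-block deterministic scan against random scan at equal
cost) under summability of both normalised autocorrelation series (`∫ g² w > 0`). -/
theorem tauInt_ordered_le_randomScanTwo
    (hK : ∀ ⦃f : X → ℝ⦄, A f → ∀ x, K f x = P₁ (P₂ f) x) (hT : ∀ ⦃f : X → ℝ⦄, A f → ∀ x, T f x = R (R f) x)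
    {g : X → ℝ} (hg : A g) (hP : 0 < ∫ x, g x ^ 2 * w x ∂μ)
    (hsK : Summable fun n => (∫ x, g x * (K^[n + 1] g) x * w x ∂μ) / ∫ x, g x ^ 2 * w x ∂μ)
    (hsT : Summable fun n => (∫ x, g x * (T^[n + 1] g) x * w x ∂μ) / ∫ x, g x ^ 2 * w x ∂μ) :
    tauInt (fun n => (∫ x, g x * (K^[n] g) x * w x ∂μ) / ∫ x, g x ^ 2 * w x ∂μ)
      ≤ tauInt (fun n => (∫ x, g x * (T^[n] g) x * w x ∂μ) / ∫ x, g x ^ 2 * w x ∂μ) := by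
  have hRm := scan_mem hAc hA1 hA2 hR
  have hRl := scan_lin hAc hlin1 hlin2 hR
  have hRs := scan_symm hAi hA1 hA2 hsymm1 hsymm2 hR
  have hRc := scan_contr hw0 hAi hA1 hA2 hcontr1 hcontr2 hR
  exact tauInt_le_nonrev hw0 hAi hAc (comp_mem hA1 hA2 hK) (comp_lin hA2 hlin1 hlin2 hK hAc)
    (comp_contr hA2 hK hcontr1 hcontr2) (comp_mem hRm hRm hT) (comp_lin hRm hRl hRl hT hAc)
    (fun f h hf hh => by
      rw [show T f = R (R f) from funext (hT hf), show T h = R (R h) from funext (hT hh),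
        hRs (hRm hf) hh, hRs hf (hRm hh)])
    (comp_contr hRm hT hRc hRc)
    (fun v hv => integral_mul_comp_le_scanTwo hAi hAc hA1 hA2 hsymm1 hsymm2 hR hw0 hK hT hv) hg hP hsK hsT

end RandomScan

end RevOp

end Summit.Ventures.LatticeQCDFlow.Exactness
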